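import Summits.ValiantsHypothesis.ValiantsHypothesis.Theorems.GrenetZeonDualUnipotentThreeHalvesLongMassNilSpaceTraceCriterion
import Summits.ValiantsHypothesis.ValiantsHypothesis.Theorems.GrenetZeonDualUnipotentThreeHalvesLongMassTriangularTwo

/-!
# `GrenetZeon.DualUnipotentThreeHalves` (stmt-ValiantsHypothesis-24318), line `slow_core`, stub (c) `SlowCore.LongMassSlowLawInv`:
# LEVITZKI'S CRITERION — every product of VALUES of the pencil nilpotent ⟺ triangularisable (the Levitzki row, `c = 2`)

The hypothesis of the research stub (c) is that every single value `B(x)` of the pencil is nilpotent (`B ^ b = 0` as a polynomial matrix).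
Levitzki's theorem (J. Levitzki 1931; Radjavi–Rosenthal, *Simultaneous Triangularization*, Thm. 2.1.7: a multiplicative SEMIGROUP of nilpotent
matrices is triangularisable) says exactly how much more the trivial menu needs: if also every finite PRODUCT of values `B(x₁)B(x₂)⋯B(x_s)` is
nilpotent, the value space is simultaneously strictly triangularisable and the pencil is (c)-cheap at `c = 2`.  So the whole content of (c) sits
in pencils with a NON-nilpotent product of (individually nilpotent) values — the cheapest wildness certificate there is (for the `3 × 3` gadget:
`B(x)B(x')` with `tr = 2`).

* §1 ★★ `conj_strictUpper_iff_words_isNilpotent` — LEVITZKI'S CRITERION for a linear space `V ≤ M_b(ℂ)`: one unit conjugates `V` into the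
  strictly upper triangular matrices iff every `V`-word of positive length is nilpotent ((⇐): nilpotent ⇒ traceless ⇒ ✓ trace criterion
  `NilSpaceEngel.conj_strictUpper_iff_trace_words_eq_zero`; (⇒): a word is conjugate to a product of strictly upper matrices).
* §2 ★ `trace_word_eq_zero_of_values_semigroup_nil` — from VALUES to the SPAN: if every product of members of a set `S` is nilpotent, every word
  in members of `span S` is traceless (the span of the semigroup generated by `S` is a product-closed space on which the trace vanishes).
* §3 ★★ THE LEVITZKI ROW `relCert_of_values_semigroup_nil` — an affine pencil `B` all of whose finite value products
  `B(x₀)B(x₁)⋯B(x_s)` are nilpotent has `RelCert n b B (2·(⌊√n⌋·b))`; `longMass_on_levitzki_locus` in the binder shape of the stub (the stub's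
  `B ^ b = 0` is the case `s = 0`).  VIOLATOR PORTRAIT (by name): a (c)-violator has points `x₀, …, x_s` with `B(x₀)⋯B(x_s)` NOT nilpotent.

HONEST FRAMING.  Calibration row / dictionary entry (`--supports stmt-ValiantsHypothesis-24318`), classical; NOT progress on the research stub (c)
`SlowCore.LongMassSlowLawInv`; closes no stub; S3, 24318, 8062 and `VP ≠ VNP` are NOT proved.  Def-free, no named-fact hypotheses, no sorry.
[cite: RadjaviRosenthal2000, Thm. 2.1.7 (Levitzki's Theorem), p0035]
-/

set_option linter.dupNamespace false
set_option autoImplicit false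

noncomputable section

namespace Summit.ValiantsHypothesis.ValiantsHypothesis.Theorems.GrenetZeon.NilSpaceLevitzki

open Matrix
open scoped BigOperators
open Summit.ValiantsHypothesis.ValiantsHypothesis.Cruxes.TwoDimCoefficients.DimTwoCases (AffMat IsAffine)
open Summit.ValiantsHypothesis.ValiantsHypothesis.Theorems.GrenetZeon.SlowCore (RelCert)
open Summit.ValiantsHypothesis.ValiantsHypothesis.Theorems.GrenetZeon.TriangularRow (relCert_of_valueSpace_triangularisable_two)
open Summit.ValiantsHypothesis.ValiantsHypothesis.Theorems.GrenetZeon.NilSpaceEngel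

variable {b : ℕ}

/-! ## §1 Levitzki's criterion for a linear space -/

/-- ★★ **LEVITZKI'S CRITERION.**  `V ≤ M_b(ℂ)` is simultaneously strictly upper triangularisable by one unit iff every `V`-word of positive
length is nilpotent. [cite: RadjaviRosenthal2000, Thm. 2.1.7 (Levitzki's Theorem), p0035] -/
theorem conj_strictUpper_iff_words_isNilpotent (V : Submodule ℂ (Matrix (Fin b) (Fin b) ℂ)) :
    (∃ P : (Matrix (Fin b) (Fin b) ℂ)ˣ, ∀ A ∈ V, ∀ i j : Fin b, j ≤ i →
        ((P : Matrix (Fin b) (Fin b) ℂ) * A * (↑P⁻¹ : Matrix (Fin b) (Fin b) ℂ)) i j = 0) ↔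
      ∀ (s : ℕ) (w : Fin (s + 1) → Matrix (Fin b) (Fin b) ℂ), (∀ t, w t ∈ V) → IsNilpotent ((List.ofFn w).prod) := by
  constructor
  · rintro ⟨P, hP⟩ s w hw
    set Pm : Matrix (Fin b) (Fin b) ℂ := (P : Matrix (Fin b) (Fin b) ℂ) with hPm
    set Qm : Matrix (Fin b) (Fin b) ℂ := (↑P⁻¹ : Matrix (Fin b) (Fin b) ℂ) with hQm
    have hQP : Qm * Pm = 1 := by rw [hPm, hQm, ← Units.val_mul, inv_mul_cancel, Units.val_one]
    -- the conjugated word is a product of strictly upper matrices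
    have hsu := strictUpper_prod_ofFn (fun t => Pm * w t * Qm) (fun t i j hji => hP _ (hw t) i j hji)
    rw [prod_ofFn_conj Pm Qm hQP w (Nat.succ_le_succ (Nat.zero_le _))] at hsu
    exact ⟨b, pow_eq_zero_of_conj_strictUpper P _ hsu⟩
  · intro hnil
    refine (conj_strictUpper_iff_trace_words_eq_zero V).mpr fun s w hw => ?_
    exact (Matrix.isNilpotent_trace_of_isNilpotent (hnil s w hw)).eq_zero

/-- ★ **One non-nilpotent word certifies wildness.** [cite: RadjaviRosenthal2000, Thm. 2.1.7 (Levitzki's Theorem), p0035] -/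
theorem not_conj_strictUpper_of_word_not_isNilpotent (V : Submodule ℂ (Matrix (Fin b) (Fin b) ℂ)) {s : ℕ}
    (w : Fin (s + 1) → Matrix (Fin b) (Fin b) ℂ) (hw : ∀ t, w t ∈ V) (hnot : ¬ IsNilpotent ((List.ofFn w).prod)) :
    ¬ ∃ P : (Matrix (Fin b) (Fin b) ℂ)ˣ, ∀ A ∈ V, ∀ i j : Fin b, j ≤ i →
      ((P : Matrix (Fin b) (Fin b) ℂ) * A * (↑P⁻¹ : Matrix (Fin b) (Fin b) ℂ)) i j = 0 :=
  fun h => hnot ((conj_strictUpper_iff_words_isNilpotent V).mp h s w hw)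

/-! ## §2 From a generating set to its span: the span of a nil semigroup is a traceless algebra -/

/-- **The span of the semigroup generated by `S` is closed under products.** -/
theorem span_semigroup_mul_mem (S : Set (Matrix (Fin b) (Fin b) ℂ)) {X Y : Matrix (Fin b) (Fin b) ℂ}
    (hX : X ∈ Submodule.span ℂ {g : Matrix (Fin b) (Fin b) ℂ | ∃ (s : ℕ) (w : Fin (s + 1) → Matrix (Fin b) (Fin b) ℂ),
      (∀ t, w t ∈ S) ∧ g = (List.ofFn w).prod})
    (hY : Y ∈ Submodule.span ℂ {g : Matrix (Fin b) (Fin b) ℂ | ∃ (s : ℕ) (w : Fin (s + 1) → Matrix (Fin b) (Fin b) ℂ),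
      (∀ t, w t ∈ S) ∧ g = (List.ofFn w).prod}) :
    X * Y ∈ Submodule.span ℂ {g : Matrix (Fin b) (Fin b) ℂ | ∃ (s : ℕ) (w : Fin (s + 1) → Matrix (Fin b) (Fin b) ℂ),
      (∀ t, w t ∈ S) ∧ g = (List.ofFn w).prod} := by
  set G : Set (Matrix (Fin b) (Fin b) ℂ) := {g | ∃ (s : ℕ) (w : Fin (s + 1) → Matrix (Fin b) (Fin b) ℂ),
      (∀ t, w t ∈ S) ∧ g = (List.ofFn w).prod} with hG
  have hgen : ∀ u ∈ G, ∀ u' ∈ G, u * u' ∈ Submodule.span ℂ G := by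
    rintro _ ⟨s₁, w₁, h₁, rfl⟩ _ ⟨s₂, w₂, h₂, rfl⟩
    have happ : (List.ofFn (Fin.append w₁ w₂ : Fin (s₁ + 1 + (s₂ + 1)) → Matrix (Fin b) (Fin b) ℂ)).prod =
        (List.ofFn w₁).prod * (List.ofFn w₂).prod := by
      rw [List.ofFn_fin_append, List.prod_append]
    refine Submodule.subset_span ⟨s₁ + 1 + s₂, (Fin.append w₁ w₂ : Fin (s₁ + 1 + (s₂ + 1)) → Matrix (Fin b) (Fin b) ℂ), ?_, happ.symm⟩
    intro t
    refine Fin.addCases (motive := fun t => Fin.append w₁ w₂ t ∈ S) (fun i => ?_) (fun i => ?_) t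
    · rw [Fin.append_left]; exact h₁ i
    · rw [Fin.append_right]; exact h₂ i
  have hleft : ∀ u ∈ G, ∀ Y' ∈ Submodule.span ℂ G, u * Y' ∈ Submodule.span ℂ G := by
    intro u hu Y' hY'
    induction hY' using Submodule.span_induction with
    | mem y hy => exact hgen u hu y hy
    | zero => rw [Matrix.mul_zero]; exact Submodule.zero_mem _
    | add y z _ _ hy hz => rw [Matrix.mul_add]; exact Submodule.add_mem _ hy hz
    | smul a y _ hy => rw [Matrix.mul_smul]; exact Submodule.smul_mem _ a hy
  induction hX using Submodule.span_induction with
  | mem x hx => exact hleft x hx Y hY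
  | zero => rw [Matrix.zero_mul]; exact Submodule.zero_mem _
  | add x z _ _ hx hz => rw [Matrix.add_mul]; exact Submodule.add_mem _ hx hz
  | smul a x _ hx => rw [Matrix.smul_mul]; exact Submodule.smul_mem _ a hx

/-- Every word (length `≥ 1`) in members of `span S` lies in the span of the semigroup generated by `S`. -/
theorem prod_mem_span_semigroup (S : Set (Matrix (Fin b) (Fin b) ℂ)) :
    ∀ {s : ℕ} (w : Fin (s + 1) → Matrix (Fin b) (Fin b) ℂ), (∀ t, w t ∈ Submodule.span ℂ S) →
      (List.ofFn w).prod ∈ Submodule.span ℂ {g : Matrix (Fin b) (Fin b) ℂ | ∃ (s : ℕ) (w : Fin (s + 1) → Matrix (Fin b) (Fin b) ℂ),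
        (∀ t, w t ∈ S) ∧ g = (List.ofFn w).prod}
  | 0, w, hw => by
    rw [List.ofFn_succ, List.ofFn_zero, List.prod_cons, List.prod_nil, Matrix.mul_one]
    -- a member of `span S` lies in the span of the (larger) semigroup
    refine Submodule.span_mono (fun y hy => ?_) (hw 0)
    exact ⟨0, fun _ => y, fun _ => hy, by rw [List.ofFn_succ, List.ofFn_zero, List.prod_cons, List.prod_nil, Matrix.mul_one]⟩
  | s + 1, w, hw => by
    rw [List.ofFn_succ, List.prod_cons]
    refine span_semigroup_mul_mem S ?_ (prod_mem_span_semigroup S (fun t => w t.succ) fun t => hw t.succ)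
    have h := prod_mem_span_semigroup S (s := 0) (fun _ => w 0) (fun _ => hw 0)
    rwa [List.ofFn_succ, List.ofFn_zero, List.prod_cons, List.prod_nil, Matrix.mul_one] at h

/-- ★ **VALUES TO SPAN.**  If every finite product (length `≥ 1`) of members of `S` is nilpotent, then every word of positive length in members
of `span S` is traceless. [cite: RadjaviRosenthal2000, Thm. 2.1.7 (Levitzki's Theorem), p0035] -/
theorem trace_word_eq_zero_of_values_semigroup_nil (S : Set (Matrix (Fin b) (Fin b) ℂ))
    (hnil : ∀ (s : ℕ) (w : Fin (s + 1) → Matrix (Fin b) (Fin b) ℂ), (∀ t, w t ∈ S) → IsNilpotent ((List.ofFn w).prod))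
    {s : ℕ} (w : Fin (s + 1) → Matrix (Fin b) (Fin b) ℂ) (hw : ∀ t, w t ∈ Submodule.span ℂ S) :
    ((List.ofFn w).prod).trace = 0 := by
  -- the trace vanishes on the semigroup, hence on its span
  have htr : ∀ X ∈ Submodule.span ℂ {g : Matrix (Fin b) (Fin b) ℂ | ∃ (s : ℕ) (w : Fin (s + 1) → Matrix (Fin b) (Fin b) ℂ),
      (∀ t, w t ∈ S) ∧ g = (List.ofFn w).prod}, X.trace = 0 := by
    intro X hX
    induction hX using Submodule.span_induction with
    | mem g hg =>
      obtain ⟨s', w', hw', rfl⟩ := hg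
      exact (Matrix.isNilpotent_trace_of_isNilpotent (hnil s' w' hw')).eq_zero
    | zero => rw [Matrix.trace_zero]
    | add y z _ _ hy hz => rw [Matrix.trace_add, hy, hz, add_zero]
    | smul c y _ hy => rw [Matrix.trace_smul, hy, smul_zero]
  exact htr _ (prod_mem_span_semigroup S w hw)

/-- ★ **Levitzki from a generating set**: if every finite product of members of `S` is nilpotent, `span S` is simultaneously strictly upper
triangularisable. [cite: RadjaviRosenthal2000, Thm. 2.1.7 (Levitzki's Theorem), p0035] -/
theorem exists_unit_conj_strictUpper_span_of_semigroup_nil (S : Set (Matrix (Fin b) (Fin b) ℂ))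
    (hnil : ∀ (s : ℕ) (w : Fin (s + 1) → Matrix (Fin b) (Fin b) ℂ), (∀ t, w t ∈ S) → IsNilpotent ((List.ofFn w).prod)) :
    ∃ P : (Matrix (Fin b) (Fin b) ℂ)ˣ, ∀ A ∈ Submodule.span ℂ S, ∀ i j : Fin b, j ≤ i →
      ((P : Matrix (Fin b) (Fin b) ℂ) * A * (↑P⁻¹ : Matrix (Fin b) (Fin b) ℂ)) i j = 0 :=
  (conj_strictUpper_iff_trace_words_eq_zero (Submodule.span ℂ S)).mpr fun _ w hw =>
    trace_word_eq_zero_of_values_semigroup_nil S hnil w hw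

/-! ## §3 THE LEVITZKI ROW of the (c)-menu -/

variable {n m : ℕ}

/-- ★★ **THE LEVITZKI ROW.**  An affine pencil `N` all of whose finite VALUE PRODUCTS `N(x₀)N(x₁)⋯N(x_s)` are nilpotent has
`RelCert n m N (2·(⌊√n⌋·m))` — (c)'s conclusion with `c = 2`, `n₀ = 0`. [cite: RadjaviRosenthal2000, Thm. 2.1.7 (Levitzki's Theorem), p0035] -/
theorem relCert_of_values_semigroup_nil (N : AffMat n m) (hN : IsAffine N)
    (hnil : ∀ (s : ℕ) (xs : Fin (s + 1) → (Fin n × Fin n → ℂ)),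
      IsNilpotent ((List.ofFn fun t => N.map (MvPolynomial.eval (xs t))).prod)) :
    RelCert n m N (2 * (Nat.sqrt n * m)) := by
  classical
  set S : Set (Matrix (Fin m) (Fin m) ℂ) := Set.range fun x : Fin n × Fin n → ℂ => N.map (MvPolynomial.eval x) with hS
  have hS' : ∀ (s : ℕ) (w : Fin (s + 1) → Matrix (Fin m) (Fin m) ℂ), (∀ t, w t ∈ S) → IsNilpotent ((List.ofFn w).prod) := by
    intro s w hw
    choose xs hxs using fun t => Set.mem_range.mp (hw t)
    have e : w = fun t => N.map (MvPolynomial.eval (xs t)) := funext fun t => (hxs t).symm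
    rw [e]; exact hnil s xs
  obtain ⟨P, hP⟩ := exists_unit_conj_strictUpper_span_of_semigroup_nil S hS'
  exact relCert_of_valueSpace_triangularisable_two N hN (Submodule.span ℂ S)
    (fun x => Submodule.subset_span ⟨x, rfl⟩) P hP

/-- ★ **(c) ON THE LEVITZKI LOCUS**, in the binder shape of the stub `SlowCore.LongMassSlowLawInv` with `c = 2`, `n₀ = 0`: the hypothesis
`B ^ b = 0` (every VALUE nilpotent) strengthened to «every finite PRODUCT of values nilpotent», `IrreducibleInv` dropped.  Contrapositive =
violator portrait: a (c)-violator has a non-nilpotent product of (nilpotent) values. [cite: RadjaviRosenthal2000, Thm. 2.1.7 (Levitzki's Theorem), p0035] -/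
theorem longMass_on_levitzki_locus :
    ∀ n b : ℕ, ∀ B : AffMat n b, IsAffine B →
      (∀ (s : ℕ) (xs : Fin (s + 1) → (Fin n × Fin n → ℂ)),
        IsNilpotent ((List.ofFn fun t => B.map (MvPolynomial.eval (xs t))).prod)) →
      RelCert n b B (2 * (Nat.sqrt n * b)) :=
  fun _ _ B hB hnil => relCert_of_values_semigroup_nil B hB hnil

end Summit.ValiantsHypothesis.ValiantsHypothesis.Theorems.GrenetZeon.NilSpaceLevitzki

end
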